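/-
Origin: expansion seat `planner-pub-hodgecm-pv02-g3-0`, handover #16 2026-08-18T06:32:59Z (`HOME/pub-hodgecm-pv02-g3/lean/Pv02g3/PerL34/S1Verdict.lean`, md5 cb7b0065, 72 lines);
landed by the gen-7 packager in gate run 25 as `HodgeCM/PerL34/S1Verdict.lean` (import ^import Pv[0-9]+g[0-9]+\.PerL34\.→import HodgeCM.PerL34. ×2; stripped 3 #print/#check/#eval lines).
-/
/-
Origin: planner-pub-hodgecm-pv02-g3-0 (unit pub-hodgecm-pv02-g3, DAG-NODE PROVER #02 gen 3), 2026-08-18.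
Proposed tree path: `HodgeCM/PerL34/S1Verdict.lean` (new, additive; capstone).  Imports my `ClassVanishing` and
`S1StrengthCRDelta` (tree names after landing).  KERNEL: nothing cited, nothing asserted.
-/
import Summits.HodgeConjecture.HodgeCM.PerL34.ClassVanishing
import Summits.HodgeConjecture.HodgeCM.PerL34.S1StrengthCRDelta

/-!
# Referee A round-15 P1 (S1 half): the strength of the S1 binders — UNCONDITIONAL VERDICT

Given node N31 (`T.Open_chars`), EACH of the four S1 open-input binders in the tree —
`CharSpansCR.WeilStepsInputCR T`, `CharSpansWeil.WeilStepsInput T`, `CharSpans.CharSpanStepsInput T` and the final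
form `CharSpansFinal.WeilStepsInputCRΔ T` — is EQUIVALENT to
`StepsVacuity.Open_thetaWedgeHereditary T ∧ S1StrengthCR.CharsNonempty T`
(hereditary A6 = the tex's Steps 1–3 conclusion in hereditary form, plus non-emptiness of the character sets).
In particular the binders are NOT strictly stronger than what the tex asserts at l. 618–641 beyond `CharsNonempty`,
and they are NOT vacuous: `weilStepsInputCR_of_hereditary'` builds the witness from hereditary A6 using the explicit
split holomorphic configuration on the ball (`SplitHolForms`, `ClassVanishing.splitHolConfig`).
All proofs are kernel-checked; no published theorem is invoked.
-/

noncomputable section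

namespace HodgeCM
namespace PerL34
namespace S1Verdict

open HodgeCM.PerL34.SplitHolForms

variable {U : Universe} (T : U.ThetaModel)

/-- (Ported verbatim from the HodgeCMPerL package; no docstring in the source.) -/
theorem weilStepsInputCR_iff (hch : T.Open_chars) :
    CharSpansCR.WeilStepsInputCR T ↔ StepsVacuity.Open_thetaWedgeHereditary T ∧ S1StrengthCR.CharsNonempty T :=
  S1StrengthCR.weilStepsInputCR_iff T splitHolConfig hch

/-- (Ported verbatim from the HodgeCMPerL package; no docstring in the source.) -/
theorem weilStepsInput_iff (hch : T.Open_chars) :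
    CharSpansWeil.WeilStepsInput T ↔ StepsVacuity.Open_thetaWedgeHereditary T ∧ S1StrengthCR.CharsNonempty T :=
  S1StrengthCR.weilStepsInput_iff T splitHolConfig hch

/-- (Ported verbatim from the HodgeCMPerL package; no docstring in the source.) -/
theorem charSpanStepsInput_iff (hch : T.Open_chars) :
    CharSpans.CharSpanStepsInput T ↔ StepsVacuity.Open_thetaWedgeHereditary T ∧ S1StrengthCR.CharsNonempty T :=
  S1StrengthCR.charSpanStepsInput_iff T splitHolConfig hch

/-- (Ported verbatim from the HodgeCMPerL package; no docstring in the source.) -/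
theorem weilStepsInputCRΔ_iff (hch : T.Open_chars) :
    CharSpansFinal.WeilStepsInputCRΔ T ↔
      StepsVacuity.Open_thetaWedgeHereditary T ∧ S1StrengthCR.CharsNonempty T :=
  S1StrengthCR.weilStepsInputCRΔ_iff T splitHolConfig hch

/-- All four binders are mutually equivalent (given N31). -/
theorem weilStepsInputCRΔ_iff_CR (hch : T.Open_chars) :
    CharSpansFinal.WeilStepsInputCRΔ T ↔ CharSpansCR.WeilStepsInputCR T :=
  S1StrengthCR.weilStepsInputCRΔ_iff_CR T splitHolConfig hch

/-- NON-VACUITY: hereditary A6 and non-empty character sets GIVE the open inputs, with no further hypothesis. -/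
theorem weilStepsInputCR_of_hereditary (hX : S1StrengthCR.CharsNonempty T)
    (h : StepsVacuity.Open_thetaWedgeHereditary T) : CharSpansCR.WeilStepsInputCR T :=
  S1StrengthCR.weilStepsInputCR_of_hereditary T splitHolConfig hX h

/-- (Ported verbatim from the HodgeCMPerL package; no docstring in the source.) -/
theorem weilStepsInputCRΔ_of_hereditary (hX : S1StrengthCR.CharsNonempty T)
    (h : StepsVacuity.Open_thetaWedgeHereditary T) : CharSpansFinal.WeilStepsInputCRΔ T :=
  S1StrengthCR.weilStepsInputCRΔ_of_hereditary T splitHolConfig hX h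

end S1Verdict
end PerL34
end HodgeCM

end

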